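/-
Copyright (c) 2026 the pub-hodgecm-mathlib formalisation cell (harness21).  Prover seat hodgecm-mathlib-K2E4-p23 (g2), Track B ∕ K2-LIT, h413 =
`stmt-HodgeConjecture-24833`, ENGINE E1, 5Res campaign «ENDGAME BY FAMILIES», RUNG 1, deal (268) of K2E1-plan (g7): the RUNG-1 PLUG EDITION — «(L²_res(U(1,1)_{L∕L⁺}))^{K_∞·K′_f}
is finite-dimensional» with the algebra∕commutation∕fixing∕exhaustion letters PLUGGED BY NAME and only the C7 structural binders and the per-block MODEL letters visible.
-/
import Summits.HodgeConjecture.HodgeConjecture.Theorems.K2E1ResidualAtomsMaximalLevelCMTwo             -- ★ p860829 (this seat): `hPfix_trivialKType`, `hχmul_of_one`, `hχinv_of_one` (+ ★ bridge p860658∕p860688∕p860758, ★ `hEXH_of_generators`)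
import Summits.HodgeConjecture.HodgeConjecture.Theorems.K2E1BlockHeckeTBLetterFreeCMTwo                 -- ★ p860686 (K2E2-p12): `lpModel_blockProj_eq_zero_letterFree_two` (hTB letter-free, D5′ with only model letters, N = 2)
import Summits.HodgeConjecture.HodgeConjecture.Theorems.K2E1ResidualSphericalFiniteMaximalLevelCMTwo    -- ★ p860792 (K2E4-p14): `residual_invariants_finiteDimensional_of_atoms_cm_two`
import HarnessLib

/-!
# K2·E1 — `K2E1ResidualSphericalFiniteMaximalLevelCMTwoOfBlocks`: RUNG 1 PLUGGED — «`(L²_res(U(J₂)_{L∕L⁺}))^{K_∞·K′_f}` IS FINITE-DIMENSIONAL» MODULO THE C7 STRUCTURAL BINDERS AND THE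
# PER-BLOCK MODEL LETTERS (deal (268): ★ p860792 ∘ ★ p860829's assembly with `hTB` ★ p860686, `hPfix` ★ p860649, `hPEis` ★ p860688∕p860758, `hEXH` ★ p860760 plugged; `hC7` fed by ★ p860784)

Track B ∕ K2-LIT, crux h413 = `stmt-HodgeConjecture-24833`, route of record `HCCMUnconditional`; cell `hodgecm-mathlib`, squad K2, ENGINE E1.  Prover seat `hodgecm-mathlib-K2E4-p23` (g2);
deal (268).  THEOREMS ONLY (no `def`, no `instance`, no notation, no named-fact hypothesis, no `sorry`); lane `--supports stmt-HodgeConjecture-24833 --as helper`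
(count-neutral).  CLOSES NO SOCKET.

SETTING.  `G = U(J)` over the CM extension `L∕L⁺`, `N = 2`, `J` with `c(J) = J`, `J² = 1`, `J ↦ (0 1; 1 0)` at every complex place (§3: `J = J₂ = (StdForm.antidiagonal 2).over L`, the three
facts ★ `antidiagonal_two_over_map`, `antidiagonal_two_over_mul_self`, `antidiagonal_two_over_map_embedding`); `K_∞ := U(J)(L⁺ ⊗ ℝ) ∩ U(1 ⊗ 1)` with `κ` the inclusion (★ K2E2-p12's frame),
`μ_K` a probability Haar measure on it; the TRIVIAL `K_∞`-type `χ ≡ 1`; a finite level `K′ ≤ G(𝔸_f)` (open) with its normalised idempotent `e`; the block projector `P = P_1 ∘L R_f(e)`;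
an adelic level `Kad ≤ closure (ι_∞κ(K_∞) ∪ ι_f(K′))` (`hKad`; M1: `Kad = K_∞ · K_max,f`); blocks `b : S` with generating sets `gen b` and coordinates `V b` (atoms `A b` finite-dimensional,
lines `L²(Ω_b; E_b)`), `U b := V b ∘ P_{closure span gen b}`; per block the spherical Hecke data `h b j` (`hhl`, `hhr`), symbols `s b j` (`hs`), `hU`, `hline` — the MODEL letters.
* §1 **`hD5_letterFree_two`** — per block, ★ `lpModel_blockProj_eq_zero_letterFree_two` (K2E2-p12: D5′ with only the model letters; `hTB` ★ inside) on `snd ∘ U b`: `(U b (P w)).2 = 0` for every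
  irreducible closed `W` and `w ∈ W`.
* §2 **`hatoms_trivialKType_letterFree_of_blocks`** — ★ `hatoms_of_noLineMass` ∘ ★ `hPfix_trivialKType` ∘ (★ `hPEis_of_letters` ∘ ★ `hEisdef_of_trivial_kType`, general `Kad`) ∘ ★ `hEXH_of_generators` ∘ §1:
  the `hatoms` clause at `(1, K′)` from `hEis : Eis(Kad) ≤ closure ⨆_b closure span gen b`, `hV` and the model letters.
* §3 **`residual_invariants_finiteDimensional_letterFree_of_blocks`** (`quasiSplit L⁺ L c 2 = cmDatum L 2 J₂`, ★ `quasiSplit_eq_cmDatum` `rfl`) — ★ p860792 ∘ §2 with the C7 triple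
  `hC7 : S(K′).Finite ∧ (blocks complete) ∧ Eis(Kad) ≤ closure ⨆ …` as ONE binder (fed VERBATIM by ★ p860784 `finite_blocks_named`): **`FiniteDimensional ℂ ((L²_res 𝔓) ⊓ K′_f-invariants ⊓
  κ(K_∞)-invariants)`**.
REMAINING VISIBLE: `hKad` + C7's structural binders (inside `hC7`), and PER BLOCK `V b ∕ hV`, `h b j ∕ hhl ∕ hhr`, `s b j ∕ hs`, `hU`, `hline` (OD: ED.2 via ★ p860754∕p860634∕p860608 after the
profile-density and all-of-H bridges; SD: K2E1-p14 lineage + (y1-c)).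
HONEST LABEL: HC_CM is proved only modulo the 7 printed citations (2 remaining named inputs: hLiu418 = `stmt-HodgeConjecture-24832`, h413 = `stmt-HodgeConjecture-24833`) until rung 0
closes; this file asserts no named fact, is conditional by construction on the visible binders, and closes no socket; count-neutral; RUNG 1 (mod model letters) ≠ 5Res.

## References
* [MoeglinWaldspurger1995] C. Mœglin, J.-L. Waldspurger, *Spectral decomposition and Eisenstein series* (1995), I.2.18, II.1.4, II.2.4, IV.3.12, V.3.13, VI.2.
* [HarishChandra1968] Harish-Chandra, *Automorphic forms on semisimple Lie groups*, LNM 62 (1968), Thm. 1.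
* [BorelJacquet1979] A. Borel, H. Jacquet, PSPM 33.1 (1979), §4.6.
-/

set_option autoImplicit false
-- the mandated namespace repeats the single-problem summit's segment (`HodgeConjecture.HodgeConjecture`)
set_option linter.dupNamespace false

noncomputable section

open MeasureTheory MeasureTheory.Measure Filter Topology CompactlySupported NumberField NumberField.mixedEmbedding NumberField.InfinitePlace ContRepresentation Set
open scoped InnerProductSpace ENNReal ComplexConjugate NNReal
open Literature.NumberTheory.Automorphic Literature.NumberTheory.Automorphic.UnitaryGroup AdelicGroupData
open Summit.HodgeConjecture.HodgeConjecture.Cruxes.H413.K2E1ResidualPartInAtomsCMTwo (hPEis_of_letters hEisdef_of_trivial_kType)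
open Summit.HodgeConjecture.HodgeConjecture.Cruxes.H413.K2E1ResidualAtomsMaximalLevelCMTwo (hPfix_trivialKType hχmul_of_one hχinv_of_one)
open Summit.HodgeConjecture.HodgeConjecture.Cruxes.H413.K2E1ResidueAtomsOfNoLineMassU (hatoms_of_noLineMass)
open Summit.HodgeConjecture.HodgeConjecture.Cruxes.H413.K2E1ResidualEisExhaustionCMTwo (hEXH_of_generators)
open Summit.HodgeConjecture.HodgeConjecture.Cruxes.H413.K2E1BlockHeckeTBLetterFreeCMTwo (lpModel_blockProj_eq_zero_letterFree_two)
open Summit.HodgeConjecture.HodgeConjecture.Cruxes.H413.K2E1ResidualSphericalFiniteMaximalLevelCMTwo (residual_invariants_finiteDimensional_of_atoms_cm_two)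
open Summit.HodgeConjecture.HodgeConjecture.Cruxes.H413.K2E1ArchTransposeKConjugateU2 (antidiagonal_two_over_map antidiagonal_two_over_mul_self antidiagonal_two_over_map_embedding)
open Summit.HodgeConjecture.HodgeConjecture.Cruxes.H413.K2E1CuspidalSpectrumUnitary

namespace Summit.HodgeConjecture.HodgeConjecture.Cruxes.H413.K2E1ResidualSphericalFiniteMaximalLevelCMTwoOfBlocks

section AnyJ

variable {L : Type} [Field L] [NumberField L] [IsCMField L] (J : Matrix (Fin 2) (Fin 2) L)
  (μ : Measure (cmDatum L 2 J).automorphicQuotient) [(cmDatum L 2 J).IsAutomorphicMeasure μ]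
  [MeasurableSpace (UnitaryGroup.arch (↥(maximalRealSubfield L)) L (IsCMField.complexConj L) 2 J)] [BorelSpace (UnitaryGroup.arch (↥(maximalRealSubfield L)) L (IsCMField.complexConj L) 2 J)]
  [MeasurableSpace (finAdelic (↥(maximalRealSubfield L)) L (IsCMField.complexConj L) 2 J)] [BorelSpace (finAdelic (↥(maximalRealSubfield L)) L (IsCMField.complexConj L) 2 J)]
  (νinf : Measure (UnitaryGroup.arch (↥(maximalRealSubfield L)) L (IsCMField.complexConj L) 2 J)) [IsHaarMeasure νinf] [νinf.IsInvInvariant] [SFinite νinf]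
  (νf : Measure (finAdelic (↥(maximalRealSubfield L)) L (IsCMField.complexConj L) 2 J)) [IsFiniteMeasureOnCompacts νf] [νf.IsMulLeftInvariant] [νf.IsInvInvariant] [νf.IsOpenPosMeasure]
  [MeasurableSpace ↥(UnitaryGroup.arch (↥(maximalRealSubfield L)) L (IsCMField.complexConj L) 2 J ⊓ unitaryGroupOfForm (conjMixed (↥(maximalRealSubfield L)) L (IsCMField.complexConj L)) 1)] [BorelSpace ↥(UnitaryGroup.arch (↥(maximalRealSubfield L)) L (IsCMField.complexConj L) 2 J ⊓ unitaryGroupOfForm (conjMixed (↥(maximalRealSubfield L)) L (IsCMField.complexConj L)) 1)]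
  (μK : Measure ↥(UnitaryGroup.arch (↥(maximalRealSubfield L)) L (IsCMField.complexConj L) 2 J ⊓ unitaryGroupOfForm (conjMixed (↥(maximalRealSubfield L)) L (IsCMField.complexConj L)) 1)) [IsProbabilityMeasure μK] [μK.IsMulLeftInvariant] [μK.IsMulRightInvariant] [μK.IsInvInvariant]
  (χ : C_c(↥(UnitaryGroup.arch (↥(maximalRealSubfield L)) L (IsCMField.complexConj L) 2 J ⊓ unitaryGroupOfForm (conjMixed (↥(maximalRealSubfield L)) L (IsCMField.complexConj L)) 1), ℂ)) (e : C_c(finAdelic (↥(maximalRealSubfield L)) L (IsCMField.complexConj L) 2 J, ℂ))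

/-! ## §1 `hD5` from the per-block MODEL letters only -/

/-- **`hD5` WITH ONLY THE MODEL LETTERS** (per block ★ `lpModel_blockProj_eq_zero_letterFree_two` on `snd ∘ U b`; `hTB` is ★ p860686 inside): for every irreducible closed `W ≤ L²(μ)`,
`w ∈ W` and block `b`, `(U b (P w)).2 = 0`. [cite: MoeglinWaldspurger1995, IV.3.12, VI.2] -/
theorem hD5_letterFree_two [ENNReal.HolderTriple ∞ 2 2]
    (hJc : J.map (IsCMField.complexConj L : L → L) = J) (hJ2 : J * J = 1)
    (hJw : ∀ w : {w : InfinitePlace L // IsComplex w}, J.map w.1.embedding = !![(0 : ℂ), 1; 1, 0])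
    (hχ1 : ∀ k, χ k = 1)
    (K' : Subgroup (finAdelic (↥(maximalRealSubfield L)) L (IsCMField.complexConj L) 2 J)) (he0 : ∀ x, x ∉ K' → e x = 0) (he1 : ∫ x, e x ∂νf = 1)
    (heK : ∀ k ∈ K', ∀ x, e (k * x) = e x) (hestar : ∀ x, mulStar (⇑e) x = e x)
    (P : (cmDatum L 2 J).L2 μ →L[ℂ] (cmDatum L 2 J).L2 μ) (hPdef : P = ((((cmDatum L 2 J).rightRegular μ).restrict ((archToAdelic (↥(maximalRealSubfield L)) L (IsCMField.complexConj L) 2 J).comp (Subgroup.inclusion (inf_le_left : UnitaryGroup.arch (↥(maximalRealSubfield L)) L (IsCMField.complexConj L) 2 J ⊓ unitaryGroupOfForm (conjMixed (↥(maximalRealSubfield L)) L (IsCMField.complexConj L)) 1 ≤ UnitaryGroup.arch (↥(maximalRealSubfield L)) L (IsCMField.complexConj L) 2 J)))).integratedOperator (((cmDatum L 2 J).isUnitary_rightRegular μ).restrict _)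
          (((cmDatum L 2 J).isStronglyContinuous_rightRegular_holds μ).restrict _ ((continuous_archToAdelic (↥(maximalRealSubfield L)) L (IsCMField.complexConj L) 2 J).comp (continuous_induced_rng.2 continuous_subtype_val))) μK χ ∘L
        (((cmDatum L 2 J).rightRegular μ).restrict (finAdelicToAdelic (↥(maximalRealSubfield L)) L (IsCMField.complexConj L) 2 J)).integratedOperator (((cmDatum L 2 J).isUnitary_rightRegular μ).restrict _) (((cmDatum L 2 J).isStronglyContinuous_rightRegular_holds μ).restrict _ (continuous_finAdelicToAdelic (↥(maximalRealSubfield L)) L (IsCMField.complexConj L) 2 J)) νf e))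
    (𝔓 : (cmDatum L 2 J).ParabolicUnipotentData)
    {S : Type*} (gen : S → Set ((cmDatum L 2 J).L2 μ))
    {A : S → Type*} [∀ b, AddCommGroup (A b)] [∀ b, Module ℂ (A b)] [∀ b, FiniteDimensional ℂ (A b)]
    {Ω : S → Type*} {mΩ : ∀ b, MeasurableSpace (Ω b)} (m : ∀ b, Measure (Ω b)) {E : S → Type*} [∀ b, NormedAddCommGroup (E b)] [∀ b, NormedSpace ℂ (E b)]
    (V : ∀ b, (cmDatum L 2 J).L2 μ →ₗ[ℂ] (A b × Lp (E b) 2 (m b)))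
    (Jb : S → Type*) [∀ b, Countable (Jb b)]
    (h : ∀ b, Jb b → C_c(UnitaryGroup.arch (↥(maximalRealSubfield L)) L (IsCMField.complexConj L) 2 J, ℂ))
    (hhl : ∀ b (j : Jb b) (k : ↥(UnitaryGroup.arch (↥(maximalRealSubfield L)) L (IsCMField.complexConj L) 2 J ⊓ unitaryGroupOfForm (conjMixed (↥(maximalRealSubfield L)) L (IsCMField.complexConj L)) 1)) (x : UnitaryGroup.arch (↥(maximalRealSubfield L)) L (IsCMField.complexConj L) 2 J), h b j ((Subgroup.inclusion (inf_le_left : UnitaryGroup.arch (↥(maximalRealSubfield L)) L (IsCMField.complexConj L) 2 J ⊓ unitaryGroupOfForm (conjMixed (↥(maximalRealSubfield L)) L (IsCMField.complexConj L)) 1 ≤ UnitaryGroup.arch (↥(maximalRealSubfield L)) L (IsCMField.complexConj L) 2 J)) k * x) = χ k * h b j x)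
    (hhr : ∀ b (j : Jb b) (k : ↥(UnitaryGroup.arch (↥(maximalRealSubfield L)) L (IsCMField.complexConj L) 2 J ⊓ unitaryGroupOfForm (conjMixed (↥(maximalRealSubfield L)) L (IsCMField.complexConj L)) 1)) (x : UnitaryGroup.arch (↥(maximalRealSubfield L)) L (IsCMField.complexConj L) 2 J), h b j (x * (Subgroup.inclusion (inf_le_left : UnitaryGroup.arch (↥(maximalRealSubfield L)) L (IsCMField.complexConj L) 2 J ⊓ unitaryGroupOfForm (conjMixed (↥(maximalRealSubfield L)) L (IsCMField.complexConj L)) 1 ≤ UnitaryGroup.arch (↥(maximalRealSubfield L)) L (IsCMField.complexConj L) 2 J)) k) = χ k * h b j x)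
    (s : ∀ b, Jb b → Ω b → ℂ) (hs : ∀ b j, MemLp (s b j) ∞ (m b))
    (hU : ∀ b j, ∀ v ∈ LinearMap.eqLocus (P : (cmDatum L 2 J).L2 μ →ₗ[ℂ] (cmDatum L 2 J).L2 μ) LinearMap.id,
      ((V b ∘ₗ (((Submodule.span ℂ (gen b)).topologicalClosure).starProjection : (cmDatum L 2 J).L2 μ →L[ℂ] (cmDatum L 2 J).L2 μ).toLinearMap) (((((cmDatum L 2 J).rightRegular μ).restrict (archToAdelic (↥(maximalRealSubfield L)) L (IsCMField.complexConj L) 2 J)).integratedOperator (((cmDatum L 2 J).isUnitary_rightRegular μ).restrict _) (((cmDatum L 2 J).isStronglyContinuous_rightRegular_holds μ).restrict _ (continuous_archToAdelic (↥(maximalRealSubfield L)) L (IsCMField.complexConj L) 2 J)) νinf (h b j) ∘L (((cmDatum L 2 J).rightRegular μ).restrict (finAdelicToAdelic (↥(maximalRealSubfield L)) L (IsCMField.complexConj L) 2 J)).integratedOperator (((cmDatum L 2 J).isUnitary_rightRegular μ).restrict _) (((cmDatum L 2 J).isStronglyContinuous_rightRegular_holds μ).restrict _ (continuous_finAdelicToAdelic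 (↥(maximalRealSubfield L)) L (IsCMField.complexConj L) 2 J)) νf e) v)).2 = ((hs b j).toLp (s b j) • ((V b ∘ₗ (((Submodule.span ℂ (gen b)).topologicalClosure).starProjection : (cmDatum L 2 J).L2 μ →L[ℂ] (cmDatum L 2 J).L2 μ).toLinearMap) v).2 : Lp (E b) 2 (m b)))
    (hline : ∀ b (c : Jb b → ℂ), m b {x | ∀ j, s b j x = c j} = 0) :
    ∀ W : ClosedSubrep (((cmDatum L 2 J).rightRegular μ)), W.toContRep.IsTopIrreducible → W ≤ residualSubspace (cmDatum L 2 J) μ 𝔓 → ∀ w ∈ W, ∀ b, ((V b ∘ₗ (((Submodule.span ℂ (gen b)).topologicalClosure).starProjection : (cmDatum L 2 J).L2 μ →L[ℂ] (cmDatum L 2 J).L2 μ).toLinearMap) (P w)).2 = 0 := by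
  intro W hW _ w hw b
  exact lpModel_blockProj_eq_zero_letterFree_two J ((cmDatum L 2 J).rightRegular μ) ((cmDatum L 2 J).isUnitary_rightRegular μ) ((cmDatum L 2 J).isStronglyContinuous_rightRegular_holds μ) νinf νf μK χ e hJc hJ2 hJw (hχmul_of_one χ hχ1) (hχ1 1) (hχinv_of_one χ hχ1)
    K' he0 he1 heK hestar P hPdef W hW (h b) (hhl b) (hhr b) ((LinearMap.snd ℂ (A b) (Lp (E b) 2 (m b))).comp (V b ∘ₗ (((Submodule.span ℂ (gen b)).topologicalClosure).starProjection : (cmDatum L 2 J).L2 μ →L[ℂ] (cmDatum L 2 J).L2 μ).toLinearMap)) (s b) (hs b)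
    (fun j v hv => hU b j v hv) (hline b) hw

/-! ## §2 The `hatoms` clause at `(1, K′)` from `hEis`, `hV` and the model letters -/

/-- **`hatoms` AT `(1, K′)`, LETTERS PLUGGED**: with an adelic level `Kad ≤ closure (ι_∞κ(K_∞) ∪ ι_f(K′))`, K2E1-p10's `Eis(Kad) = (L²_cusp(𝔓))ᗮ ⊓ L²^{Kad}`, the exhaustion
`hEis : Eis(Kad) ≤ closure ⨆_b closure span gen b` (★ C7), coordinates `V b` injective on the blocks and the per-block model letters: `∃ P′ A′` finite-dimensional with the fix-clause and
`P′ w ∈ A′` on the irreducible residual `W`. [cite: MoeglinWaldspurger1995, I.2.18, V.3.13] [cite: BorelJacquet1979, §4.6] -/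
theorem hatoms_trivialKType_letterFree_of_blocks [MeasurableMul (finAdelic (↥(maximalRealSubfield L)) L (IsCMField.complexConj L) 2 J)] [ENNReal.HolderTriple ∞ 2 2]
    (hJc : J.map (IsCMField.complexConj L : L → L) = J) (hJ2 : J * J = 1)
    (hJw : ∀ w : {w : InfinitePlace L // IsComplex w}, J.map w.1.embedding = !![(0 : ℂ), 1; 1, 0])
    (hχ1 : ∀ k, χ k = 1)
    (K' : Subgroup (finAdelic (↥(maximalRealSubfield L)) L (IsCMField.complexConj L) 2 J)) (hK'o : IsOpen (K' : Set (finAdelic (↥(maximalRealSubfield L)) L (IsCMField.complexConj L) 2 J))) (he0 : ∀ x, x ∉ K' → e x = 0) (he1 : ∫ x, e x ∂νf = 1)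
    (heK : ∀ k ∈ K', ∀ x, e (k * x) = e x) (hestar : ∀ x, mulStar (⇑e) x = e x)
    (P : (cmDatum L 2 J).L2 μ →L[ℂ] (cmDatum L 2 J).L2 μ) (hPdef : P = ((((cmDatum L 2 J).rightRegular μ).restrict ((archToAdelic (↥(maximalRealSubfield L)) L (IsCMField.complexConj L) 2 J).comp (Subgroup.inclusion (inf_le_left : UnitaryGroup.arch (↥(maximalRealSubfield L)) L (IsCMField.complexConj L) 2 J ⊓ unitaryGroupOfForm (conjMixed (↥(maximalRealSubfield L)) L (IsCMField.complexConj L)) 1 ≤ UnitaryGroup.arch (↥(maximalRealSubfield L)) L (IsCMField.complexConj L) 2 J)))).integratedOperator (((cmDatum L 2 J).isUnitary_rightRegular μ).restrict _)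
          (((cmDatum L 2 J).isStronglyContinuous_rightRegular_holds μ).restrict _ ((continuous_archToAdelic (↥(maximalRealSubfield L)) L (IsCMField.complexConj L) 2 J).comp (continuous_induced_rng.2 continuous_subtype_val))) μK χ ∘L
        (((cmDatum L 2 J).rightRegular μ).restrict (finAdelicToAdelic (↥(maximalRealSubfield L)) L (IsCMField.complexConj L) 2 J)).integratedOperator (((cmDatum L 2 J).isUnitary_rightRegular μ).restrict _) (((cmDatum L 2 J).isStronglyContinuous_rightRegular_holds μ).restrict _ (continuous_finAdelicToAdelic (↥(maximalRealSubfield L)) L (IsCMField.complexConj L) 2 J)) νf e))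
    (𝔓 : (cmDatum L 2 J).ParabolicUnipotentData)
    (Kad : Subgroup (cmDatum L 2 J).Adelic) (hKad : Kad ≤ (Subgroup.closure (Set.range (fun k : ↥(UnitaryGroup.arch (↥(maximalRealSubfield L)) L (IsCMField.complexConj L) 2 J ⊓ unitaryGroupOfForm (conjMixed (↥(maximalRealSubfield L)) L (IsCMField.complexConj L)) 1) => (archToAdelic (↥(maximalRealSubfield L)) L (IsCMField.complexConj L) 2 J) ((Subgroup.inclusion (inf_le_left : UnitaryGroup.arch (↥(maximalRealSubfield L)) L (IsCMField.complexConj L) 2 J ⊓ unitaryGroupOfForm (conjMixed (↥(maximalRealSubfield L)) L (IsCMField.complexConj L)) 1 ≤ UnitaryGroup.arch (↥(maximalRealSubfield L)) L (IsCMField.complexConj L) 2 J)) k)) ∪ (finAdelicToAdelic (↥(maximalRealSubfield L)) L (IsCMField.complexConj L) 2 J) '' (K' : Set (finAdelic (↥(maximalRealSubfield L)) L (IsCMField.complexConj L) 2 J)))))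
    {S : Type*} (gen : S → Set ((cmDatum L 2 J).L2 μ))
    {A : S → Type*} [∀ b, AddCommGroup (A b)] [∀ b, Module ℂ (A b)] [∀ b, FiniteDimensional ℂ (A b)]
    {Ω : S → Type*} {mΩ : ∀ b, MeasurableSpace (Ω b)} (m : ∀ b, Measure (Ω b)) {E : S → Type*} [∀ b, NormedAddCommGroup (E b)] [∀ b, NormedSpace ℂ (E b)]
    (V : ∀ b, (cmDatum L 2 J).L2 μ →ₗ[ℂ] (A b × Lp (E b) 2 (m b)))
    (Jb : S → Type*) [∀ b, Countable (Jb b)]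
    (h : ∀ b, Jb b → C_c(UnitaryGroup.arch (↥(maximalRealSubfield L)) L (IsCMField.complexConj L) 2 J, ℂ))
    (hhl : ∀ b (j : Jb b) (k : ↥(UnitaryGroup.arch (↥(maximalRealSubfield L)) L (IsCMField.complexConj L) 2 J ⊓ unitaryGroupOfForm (conjMixed (↥(maximalRealSubfield L)) L (IsCMField.complexConj L)) 1)) (x : UnitaryGroup.arch (↥(maximalRealSubfield L)) L (IsCMField.complexConj L) 2 J), h b j ((Subgroup.inclusion (inf_le_left : UnitaryGroup.arch (↥(maximalRealSubfield L)) L (IsCMField.complexConj L) 2 J ⊓ unitaryGroupOfForm (conjMixed (↥(maximalRealSubfield L)) L (IsCMField.complexConj L)) 1 ≤ UnitaryGroup.arch (↥(maximalRealSubfield L)) L (IsCMField.complexConj L) 2 J)) k * x) = χ k * h b j x)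
    (hhr : ∀ b (j : Jb b) (k : ↥(UnitaryGroup.arch (↥(maximalRealSubfield L)) L (IsCMField.complexConj L) 2 J ⊓ unitaryGroupOfForm (conjMixed (↥(maximalRealSubfield L)) L (IsCMField.complexConj L)) 1)) (x : UnitaryGroup.arch (↥(maximalRealSubfield L)) L (IsCMField.complexConj L) 2 J), h b j (x * (Subgroup.inclusion (inf_le_left : UnitaryGroup.arch (↥(maximalRealSubfield L)) L (IsCMField.complexConj L) 2 J ⊓ unitaryGroupOfForm (conjMixed (↥(maximalRealSubfield L)) L (IsCMField.complexConj L)) 1 ≤ UnitaryGroup.arch (↥(maximalRealSubfield L)) L (IsCMField.complexConj L) 2 J)) k) = χ k * h b j x)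
    (s : ∀ b, Jb b → Ω b → ℂ) (hs : ∀ b j, MemLp (s b j) ∞ (m b))
    (hU : ∀ b j, ∀ v ∈ LinearMap.eqLocus (P : (cmDatum L 2 J).L2 μ →ₗ[ℂ] (cmDatum L 2 J).L2 μ) LinearMap.id,
      ((V b ∘ₗ (((Submodule.span ℂ (gen b)).topologicalClosure).starProjection : (cmDatum L 2 J).L2 μ →L[ℂ] (cmDatum L 2 J).L2 μ).toLinearMap) (((((cmDatum L 2 J).rightRegular μ).restrict (archToAdelic (↥(maximalRealSubfield L)) L (IsCMField.complexConj L) 2 J)).integratedOperator (((cmDatum L 2 J).isUnitary_rightRegular μ).restrict _) (((cmDatum L 2 J).isStronglyContinuous_rightRegular_holds μ).restrict _ (continuous_archToAdelic (↥(maximalRealSubfield L)) L (IsCMField.complexConj L) 2 J)) νinf (h b j) ∘L (((cmDatum L 2 J).rightRegular μ).restrict (finAdelicToAdelic (↥(maximalRealSubfield L)) L (IsCMField.complexConj L) 2 J)).integratedOperator (((cmDatum L 2 J).isUnitary_rightRegular μ).restrict _) (((cmDatum L 2 J).isStronglyContinuous_rightRegular_holds μ).restrict _ (continuous_finAdelicToAdelic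 (↥(maximalRealSubfield L)) L (IsCMField.complexConj L) 2 J)) νf e) v)).2 = ((hs b j).toLp (s b j) • ((V b ∘ₗ (((Submodule.span ℂ (gen b)).topologicalClosure).starProjection : (cmDatum L 2 J).L2 μ →L[ℂ] (cmDatum L 2 J).L2 μ).toLinearMap) v).2 : Lp (E b) 2 (m b)))
    (hline : ∀ b (c : Jb b → ℂ), m b {x | ∀ j, s b j x = c j} = 0)
    [Finite S] (hV : ∀ b, ∀ y ∈ (Submodule.span ℂ (gen b)).topologicalClosure, V b y = 0 → y = 0)
    (hEis : (((cmDatum L 2 J).cuspidalSubspace μ 𝔓).toSubmoduleᗮ ⊓ ((((cmDatum L 2 J).rightRegular μ)).restrict Kad.subtype).invariants) ≤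
      (⨆ b, (Submodule.span ℂ (gen b)).topologicalClosure).topologicalClosure) :
    ∃ (P' : (cmDatum L 2 J).L2 μ →L[ℂ] (cmDatum L 2 J).L2 μ) (A' : Submodule ℂ ((cmDatum L 2 J).L2 μ)), FiniteDimensional ℂ A' ∧
      (∀ x : (cmDatum L 2 J).L2 μ, (∀ u ∈ (⟨K', hK'o⟩ : OpenSubgroup (finAdelic (↥(maximalRealSubfield L)) L (IsCMField.complexConj L) 2 J)), ((cmDatum L 2 J).rightRegular μ) ((MonoidHom.id (cmDatum L 2 J).Adelic) ((finAdelicToAdelic (↥(maximalRealSubfield L)) L (IsCMField.complexConj L) 2 J) u)) x = x) →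
        (∀ t : ↥(UnitaryGroup.arch (↥(maximalRealSubfield L)) L (IsCMField.complexConj L) 2 J ⊓ unitaryGroupOfForm (conjMixed (↥(maximalRealSubfield L)) L (IsCMField.complexConj L)) 1), ((cmDatum L 2 J).rightRegular μ) ((MonoidHom.id (cmDatum L 2 J).Adelic) (((archToAdelic (↥(maximalRealSubfield L)) L (IsCMField.complexConj L) 2 J).comp (Subgroup.inclusion (inf_le_left : UnitaryGroup.arch (↥(maximalRealSubfield L)) L (IsCMField.complexConj L) 2 J ⊓ unitaryGroupOfForm (conjMixed (↥(maximalRealSubfield L)) L (IsCMField.complexConj L)) 1 ≤ UnitaryGroup.arch (↥(maximalRealSubfield L)) L (IsCMField.complexConj L) 2 J))) t)) x = (1 : ↥(UnitaryGroup.arch (↥(maximalRealSubfield L)) L (IsCMField.complexConj L) 2 J ⊓ unitaryGroupOfForm (conjMixed (↥(maximalRealSubfield L)) L (IsCMField.complexConj L)) 1) →* ℂ) t • x) → P' x = x) ∧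
      ∀ W : ClosedSubrep (((cmDatum L 2 J).rightRegular μ)), W.toContRep.IsTopIrreducible → W ≤ residualSubspace (cmDatum L 2 J) μ 𝔓 → ∀ w ∈ W, P' w ∈ A' :=
  hatoms_of_noLineMass (cmDatum L 2 J) μ 𝔓 (MonoidHom.id (cmDatum L 2 J).Adelic) ((archToAdelic (↥(maximalRealSubfield L)) L (IsCMField.complexConj L) 2 J).comp (Subgroup.inclusion (inf_le_left : UnitaryGroup.arch (↥(maximalRealSubfield L)) L (IsCMField.complexConj L) 2 J ⊓ unitaryGroupOfForm (conjMixed (↥(maximalRealSubfield L)) L (IsCMField.complexConj L)) 1 ≤ UnitaryGroup.arch (↥(maximalRealSubfield L)) L (IsCMField.complexConj L) 2 J))) (finAdelicToAdelic (↥(maximalRealSubfield L)) L (IsCMField.complexConj L) 2 J) (1 : ↥(UnitaryGroup.arch (↥(maximalRealSubfield L)) L (IsCMField.complexConj L) 2 J ⊓ unitaryGroupOfForm (conjMixed (↥(maximalRealSubfield L)) L (IsCMField.complexConj L)) 1) →* ℂ) ⟨K', hK'o⟩ P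
    (hPfix_trivialKType μ νf (Subgroup.inclusion (inf_le_left : UnitaryGroup.arch (↥(maximalRealSubfield L)) L (IsCMField.complexConj L) 2 J ⊓ unitaryGroupOfForm (conjMixed (↥(maximalRealSubfield L)) L (IsCMField.complexConj L)) 1 ≤ UnitaryGroup.arch (↥(maximalRealSubfield L)) L (IsCMField.complexConj L) 2 J)) (continuous_induced_rng.2 continuous_subtype_val) μK χ e hχ1 K' hK'o he0 he1 P hPdef)
    (((cmDatum L 2 J).cuspidalSubspace μ 𝔓).toSubmoduleᗮ ⊓ ((((cmDatum L 2 J).rightRegular μ)).restrict Kad.subtype).invariants)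
    (fun b => (V b ∘ₗ (((Submodule.span ℂ (gen b)).topologicalClosure).starProjection : (cmDatum L 2 J).L2 μ →L[ℂ] (cmDatum L 2 J).L2 μ).toLinearMap))
    (hEXH_of_generators (cmDatum L 2 J) μ gen (((cmDatum L 2 J).cuspidalSubspace μ 𝔓).toSubmoduleᗮ ⊓ ((((cmDatum L 2 J).rightRegular μ)).restrict Kad.subtype).invariants) hEis V hV)
    (hPEis_of_letters μ νf (Subgroup.inclusion (inf_le_left : UnitaryGroup.arch (↥(maximalRealSubfield L)) L (IsCMField.complexConj L) 2 J ⊓ unitaryGroupOfForm (conjMixed (↥(maximalRealSubfield L)) L (IsCMField.complexConj L)) 1 ≤ UnitaryGroup.arch (↥(maximalRealSubfield L)) L (IsCMField.complexConj L) 2 J)) (continuous_induced_rng.2 continuous_subtype_val) μK χ e (hχmul_of_one χ hχ1) (hχ1 1) K' he0 he1 heK P hPdef 𝔓 (((cmDatum L 2 J).cuspidalSubspace μ 𝔓).toSubmoduleᗮ ⊓ ((((cmDatum L 2 J).rightRegular μ)).restrict Kad.subtype).invariants)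
      (hEisdef_of_trivial_kType μ νf (Subgroup.inclusion (inf_le_left : UnitaryGroup.arch (↥(maximalRealSubfield L)) L (IsCMField.complexConj L) 2 J ⊓ unitaryGroupOfForm (conjMixed (↥(maximalRealSubfield L)) L (IsCMField.complexConj L)) 1 ≤ UnitaryGroup.arch (↥(maximalRealSubfield L)) L (IsCMField.complexConj L) 2 J)) (continuous_induced_rng.2 continuous_subtype_val) μK χ e hχ1 K' heK P hPdef 𝔓 Kad hKad))
    (hD5_letterFree_two J μ νinf νf μK χ e hJc hJ2 hJw hχ1 K' he0 he1 heK hestar P hPdef 𝔓 gen m V Jb h hhl hhr s hs hU hline)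

/-! ## §3 RUNG 1 plugged: `(L²_res(U(J)_{L∕L⁺}))^{K_∞·K′_f}` is finite-dimensional, modulo the C7 triple and the model letters -/

/-- **RUNG 1, PLUG EDITION (any admissible `J`)**: for every Borel-type datum `𝔓`, the trivial `K_∞`-type, an open finite level `K′ ≤ G(𝔸_f)` and an adelic level
`Kad ≤ closure (ι_∞(K_∞) ∪ ι_f(K′))`: GIVEN the C7 triple `hC7` (`S(K′)` finite, blocks complete, `Eis(Kad) ≤ closure ⨆_b block_b` — for `J = J₂` fed VERBATIM by ★ `finite_blocks_named`), block
coordinates `V b` injective on the blocks, and the per-block MODEL letters (`h b j` spherical, symbols `s b j`, `hU`, `hline`), **the `K′`-invariant, `K_∞`-invariant part of `L²_res(𝔓)` is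
FINITE-DIMENSIONAL** — ★ `residual_invariants_finiteDimensional_of_atoms` (K2E4-p14, generic `𝒢`) ∘ §2. [cite: MoeglinWaldspurger1995, I.2.18, V.3.13] [cite: HarishChandra1968, Thm. 1] -/
theorem residual_invariants_finiteDimensional_letterFree_of_blocks [MeasurableMul (finAdelic (↥(maximalRealSubfield L)) L (IsCMField.complexConj L) 2 J)] [ENNReal.HolderTriple ∞ 2 2]
    (hJc : J.map (IsCMField.complexConj L : L → L) = J) (hJ2 : J * J = 1)
    (hJw : ∀ w : {w : InfinitePlace L // IsComplex w}, J.map w.1.embedding = !![(0 : ℂ), 1; 1, 0])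
    (hχ1 : ∀ k, χ k = 1)
    (K' : Subgroup (finAdelic (↥(maximalRealSubfield L)) L (IsCMField.complexConj L) 2 J)) (hK'o : IsOpen (K' : Set (finAdelic (↥(maximalRealSubfield L)) L (IsCMField.complexConj L) 2 J))) (he0 : ∀ x, x ∉ K' → e x = 0) (he1 : ∫ x, e x ∂νf = 1)
    (heK : ∀ k ∈ K', ∀ x, e (k * x) = e x) (hestar : ∀ x, mulStar (⇑e) x = e x)
    (P : (cmDatum L 2 J).L2 μ →L[ℂ] (cmDatum L 2 J).L2 μ) (hPdef : P = ((((cmDatum L 2 J).rightRegular μ).restrict ((archToAdelic (↥(maximalRealSubfield L)) L (IsCMField.complexConj L) 2 J).comp (Subgroup.inclusion (inf_le_left : UnitaryGroup.arch (↥(maximalRealSubfield L)) L (IsCMField.complexConj L) 2 J ⊓ unitaryGroupOfForm (conjMixed (↥(maximalRealSubfield L)) L (IsCMField.complexConj L)) 1 ≤ UnitaryGroup.arch (↥(maximalRealSubfield L)) L (IsCMField.complexConj L) 2 J)))).integratedOperator (((cmDatum L 2 J).isUnitary_rightRegular μ).restrict _)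
          (((cmDatum L 2 J).isStronglyContinuous_rightRegular_holds μ).restrict _ ((continuous_archToAdelic (↥(maximalRealSubfield L)) L (IsCMField.complexConj L) 2 J).comp (continuous_induced_rng.2 continuous_subtype_val))) μK χ ∘L
        (((cmDatum L 2 J).rightRegular μ).restrict (finAdelicToAdelic (↥(maximalRealSubfield L)) L (IsCMField.complexConj L) 2 J)).integratedOperator (((cmDatum L 2 J).isUnitary_rightRegular μ).restrict _) (((cmDatum L 2 J).isStronglyContinuous_rightRegular_holds μ).restrict _ (continuous_finAdelicToAdelic (↥(maximalRealSubfield L)) L (IsCMField.complexConj L) 2 J)) νf e))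
    (𝔓 : (cmDatum L 2 J).ParabolicUnipotentData)
    (Kad : Subgroup (cmDatum L 2 J).Adelic) (hKad : Kad ≤ (Subgroup.closure (Set.range (fun k : ↥(UnitaryGroup.arch (↥(maximalRealSubfield L)) L (IsCMField.complexConj L) 2 J ⊓ unitaryGroupOfForm (conjMixed (↥(maximalRealSubfield L)) L (IsCMField.complexConj L)) 1) => (archToAdelic (↥(maximalRealSubfield L)) L (IsCMField.complexConj L) 2 J) ((Subgroup.inclusion (inf_le_left : UnitaryGroup.arch (↥(maximalRealSubfield L)) L (IsCMField.complexConj L) 2 J ⊓ unitaryGroupOfForm (conjMixed (↥(maximalRealSubfield L)) L (IsCMField.complexConj L)) 1 ≤ UnitaryGroup.arch (↥(maximalRealSubfield L)) L (IsCMField.complexConj L) 2 J)) k)) ∪ (finAdelicToAdelic (↥(maximalRealSubfield L)) L (IsCMField.complexConj L) 2 J) '' (K' : Set (finAdelic (↥(maximalRealSubfield L)) L (IsCMField.complexConj L) 2 J)))))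
    {ι : Type*} {SK : Set ι} (gen : ↥SK → Set ((cmDatum L 2 J).L2 μ))
    {A : ↥SK → Type*} [∀ b, AddCommGroup (A b)] [∀ b, Module ℂ (A b)] [∀ b, FiniteDimensional ℂ (A b)]
    {Ω : ↥SK → Type*} {mΩ : ∀ b, MeasurableSpace (Ω b)} (m : ∀ b, Measure (Ω b)) {E : ↥SK → Type*} [∀ b, NormedAddCommGroup (E b)] [∀ b, NormedSpace ℂ (E b)]
    (V : ∀ b, (cmDatum L 2 J).L2 μ →ₗ[ℂ] (A b × Lp (E b) 2 (m b)))
    (Jb : ↥SK → Type*) [∀ b, Countable (Jb b)]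
    (h : ∀ b, Jb b → C_c(UnitaryGroup.arch (↥(maximalRealSubfield L)) L (IsCMField.complexConj L) 2 J, ℂ))
    (hhl : ∀ b (j : Jb b) (k : ↥(UnitaryGroup.arch (↥(maximalRealSubfield L)) L (IsCMField.complexConj L) 2 J ⊓ unitaryGroupOfForm (conjMixed (↥(maximalRealSubfield L)) L (IsCMField.complexConj L)) 1)) (x : UnitaryGroup.arch (↥(maximalRealSubfield L)) L (IsCMField.complexConj L) 2 J), h b j ((Subgroup.inclusion (inf_le_left : UnitaryGroup.arch (↥(maximalRealSubfield L)) L (IsCMField.complexConj L) 2 J ⊓ unitaryGroupOfForm (conjMixed (↥(maximalRealSubfield L)) L (IsCMField.complexConj L)) 1 ≤ UnitaryGroup.arch (↥(maximalRealSubfield L)) L (IsCMField.complexConj L) 2 J)) k * x) = χ k * h b j x)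
    (hhr : ∀ b (j : Jb b) (k : ↥(UnitaryGroup.arch (↥(maximalRealSubfield L)) L (IsCMField.complexConj L) 2 J ⊓ unitaryGroupOfForm (conjMixed (↥(maximalRealSubfield L)) L (IsCMField.complexConj L)) 1)) (x : UnitaryGroup.arch (↥(maximalRealSubfield L)) L (IsCMField.complexConj L) 2 J), h b j (x * (Subgroup.inclusion (inf_le_left : UnitaryGroup.arch (↥(maximalRealSubfield L)) L (IsCMField.complexConj L) 2 J ⊓ unitaryGroupOfForm (conjMixed (↥(maximalRealSubfield L)) L (IsCMField.complexConj L)) 1 ≤ UnitaryGroup.arch (↥(maximalRealSubfield L)) L (IsCMField.complexConj L) 2 J)) k) = χ k * h b j x)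
    (s : ∀ b, Jb b → Ω b → ℂ) (hs : ∀ b j, MemLp (s b j) ∞ (m b))
    (hU : ∀ b j, ∀ v ∈ LinearMap.eqLocus (P : (cmDatum L 2 J).L2 μ →ₗ[ℂ] (cmDatum L 2 J).L2 μ) LinearMap.id,
      ((V b ∘ₗ (((Submodule.span ℂ (gen b)).topologicalClosure).starProjection : (cmDatum L 2 J).L2 μ →L[ℂ] (cmDatum L 2 J).L2 μ).toLinearMap) (((((cmDatum L 2 J).rightRegular μ).restrict (archToAdelic (↥(maximalRealSubfield L)) L (IsCMField.complexConj L) 2 J)).integratedOperator (((cmDatum L 2 J).isUnitary_rightRegular μ).restrict _) (((cmDatum L 2 J).isStronglyContinuous_rightRegular_holds μ).restrict _ (continuous_archToAdelic (↥(maximalRealSubfield L)) L (IsCMField.complexConj L) 2 J)) νinf (h b j) ∘L (((cmDatum L 2 J).rightRegular μ).restrict (finAdelicToAdelic (↥(maximalRealSubfield L)) L (IsCMField.complexConj L) 2 J)).integratedOperator (((cmDatum L 2 J).isUnitary_rightRegular μ).restrict _) (((cmDatum L 2 J).isStronglyContinuous_rightRegular_holds μ).restrict _ (continuous_finAdelicToAdelic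 (↥(maximalRealSubfield L)) L (IsCMField.complexConj L) 2 J)) νf e) v)).2 = ((hs b j).toLp (s b j) • ((V b ∘ₗ (((Submodule.span ℂ (gen b)).topologicalClosure).starProjection : (cmDatum L 2 J).L2 μ →L[ℂ] (cmDatum L 2 J).L2 μ).toLinearMap) v).2 : Lp (E b) 2 (m b)))
    (hline : ∀ b (c : Jb b → ℂ), m b {x | ∀ j, s b j x = c j} = 0)
    (hV : ∀ b, ∀ y ∈ (Submodule.span ℂ (gen b)).topologicalClosure, V b y = 0 → y = 0)
    (hC7 : SK.Finite ∧ (∀ b : ↥SK, CompleteSpace ↥(Submodule.span ℂ (gen b)).topologicalClosure) ∧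
      (((cmDatum L 2 J).cuspidalSubspace μ 𝔓).toSubmoduleᗮ ⊓ ((((cmDatum L 2 J).rightRegular μ)).restrict Kad.subtype).invariants) ≤ (⨆ b, (Submodule.span ℂ (gen b)).topologicalClosure).topologicalClosure) :
    FiniteDimensional ℂ ↥((residualSubspace (cmDatum L 2 J) μ 𝔓).toSubmodule ⊓
      ((((cmDatum L 2 J).rightRegular μ)).restrict ((finAdelicToAdelic (↥(maximalRealSubfield L)) L (IsCMField.complexConj L) 2 J).comp K'.subtype)).invariants ⊓
      ((((cmDatum L 2 J).rightRegular μ)).restrict ((archToAdelic (↥(maximalRealSubfield L)) L (IsCMField.complexConj L) 2 J).comp (Subgroup.inclusion (inf_le_left : UnitaryGroup.arch (↥(maximalRealSubfield L)) L (IsCMField.complexConj L) 2 J ⊓ unitaryGroupOfForm (conjMixed (↥(maximalRealSubfield L)) L (IsCMField.complexConj L)) 1 ≤ UnitaryGroup.arch (↥(maximalRealSubfield L)) L (IsCMField.complexConj L) 2 J)))).invariants) := by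
  haveI : Finite ↥SK := hC7.1.to_subtype
  obtain ⟨P', A', hA', hfix, hmem⟩ := hatoms_trivialKType_letterFree_of_blocks J μ νinf νf μK χ e hJc hJ2 hJw
    hχ1 K' hK'o he0 he1 heK hestar P hPdef 𝔓 Kad hKad gen m V Jb h hhl hhr s hs hU hline hV hC7.2.2
  refine K2E1ResidualSphericalFiniteMaximalLevelCMTwo.residual_invariants_finiteDimensional_of_atoms (cmDatum L 2 J) μ 𝔓 ((archToAdelic (↥(maximalRealSubfield L)) L (IsCMField.complexConj L) 2 J).comp (Subgroup.inclusion (inf_le_left : UnitaryGroup.arch (↥(maximalRealSubfield L)) L (IsCMField.complexConj L) 2 J ⊓ unitaryGroupOfForm (conjMixed (↥(maximalRealSubfield L)) L (IsCMField.complexConj L)) 1 ≤ UnitaryGroup.arch (↥(maximalRealSubfield L)) L (IsCMField.complexConj L) 2 J))) (finAdelicToAdelic (↥(maximalRealSubfield L)) L (IsCMField.complexConj L) 2 J) K'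
    ⟨P', A', hA', fun x hxU hxK => hfix x (fun u hu => hxU u hu) (fun t => ?_), hmem⟩
  rw [MonoidHom.one_apply, one_smul]
  exact hxK t

/-! ## §4 The M1 group `U(1,1)_{L∕L⁺} = U(J₂)`: the three `J₂` facts discharged -/

end AnyJ

section JTwo

variable {L : Type} [Field L] [NumberField L] [IsCMField L]

/-- **RUNG 1 FOR `U(1,1)_{L∕L⁺} = U(J₂)`** (`J₂ = (StdForm.antidiagonal 2).over L`; `cmDatum L 2 J₂ = quasiSplit L⁺ L c 2` by ★ `quasiSplit_eq_cmDatum`, `rfl`): §3 with `c(J₂) = J₂`, `J₂² = 1`,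
`σ_w(J₂) = (0 1; 1 0)` (★ `antidiagonal_two_over_map`, `…_mul_self`, `…_map_embedding`) DISCHARGED — the M1 statement «`(L²_res(U(1,1)_{L∕L⁺}))^{K_∞·K′_f}` is finite-dimensional»
modulo the C7 triple (★ p860784 verbatim at `K′ = Kad`) and the per-block model letters. [cite: MoeglinWaldspurger1995, I.2.18, V.3.13] [cite: HarishChandra1968, Thm. 1] -/
theorem residual_invariants_finiteDimensional_letterFree_of_blocks_J₂
    (μ : Measure (cmDatum L 2 ((StdForm.antidiagonal 2).over L)).automorphicQuotient) [(cmDatum L 2 ((StdForm.antidiagonal 2).over L)).IsAutomorphicMeasure μ]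
    [MeasurableSpace (UnitaryGroup.arch (↥(maximalRealSubfield L)) L (IsCMField.complexConj L) 2 ((StdForm.antidiagonal 2).over L))] [BorelSpace (UnitaryGroup.arch (↥(maximalRealSubfield L)) L (IsCMField.complexConj L) 2 ((StdForm.antidiagonal 2).over L))]
    [MeasurableSpace (finAdelic (↥(maximalRealSubfield L)) L (IsCMField.complexConj L) 2 ((StdForm.antidiagonal 2).over L))] [BorelSpace (finAdelic (↥(maximalRealSubfield L)) L (IsCMField.complexConj L) 2 ((StdForm.antidiagonal 2).over L))]
    (νinf : Measure (UnitaryGroup.arch (↥(maximalRealSubfield L)) L (IsCMField.complexConj L) 2 ((StdForm.antidiagonal 2).over L))) [IsHaarMeasure νinf] [νinf.IsInvInvariant] [SFinite νinf]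
    (νf : Measure (finAdelic (↥(maximalRealSubfield L)) L (IsCMField.complexConj L) 2 ((StdForm.antidiagonal 2).over L))) [IsFiniteMeasureOnCompacts νf] [νf.IsMulLeftInvariant] [νf.IsInvInvariant] [νf.IsOpenPosMeasure] [MeasurableMul (finAdelic (↥(maximalRealSubfield L)) L (IsCMField.complexConj L) 2 ((StdForm.antidiagonal 2).over L))]
    [MeasurableSpace ↥(UnitaryGroup.arch (↥(maximalRealSubfield L)) L (IsCMField.complexConj L) 2 ((StdForm.antidiagonal 2).over L) ⊓ unitaryGroupOfForm (conjMixed (↥(maximalRealSubfield L)) L (IsCMField.complexConj L)) 1)] [BorelSpace ↥(UnitaryGroup.arch (↥(maximalRealSubfield L)) L (IsCMField.complexConj L) 2 ((StdForm.antidiagonal 2).over L) ⊓ unitaryGroupOfForm (conjMixed (↥(maximalRealSubfield L)) L (IsCMField.complexConj L)) 1)]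
    (μK : Measure ↥(UnitaryGroup.arch (↥(maximalRealSubfield L)) L (IsCMField.complexConj L) 2 ((StdForm.antidiagonal 2).over L) ⊓ unitaryGroupOfForm (conjMixed (↥(maximalRealSubfield L)) L (IsCMField.complexConj L)) 1)) [IsProbabilityMeasure μK] [μK.IsMulLeftInvariant] [μK.IsMulRightInvariant] [μK.IsInvInvariant]
    (χ : C_c(↥(UnitaryGroup.arch (↥(maximalRealSubfield L)) L (IsCMField.complexConj L) 2 ((StdForm.antidiagonal 2).over L) ⊓ unitaryGroupOfForm (conjMixed (↥(maximalRealSubfield L)) L (IsCMField.complexConj L)) 1), ℂ)) (e : C_c(finAdelic (↥(maximalRealSubfield L)) L (IsCMField.complexConj L) 2 ((StdForm.antidiagonal 2).over L), ℂ)) [ENNReal.HolderTriple ∞ 2 2]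
    (hχ1 : ∀ k, χ k = 1)
    (K' : Subgroup (finAdelic (↥(maximalRealSubfield L)) L (IsCMField.complexConj L) 2 ((StdForm.antidiagonal 2).over L))) (hK'o : IsOpen (K' : Set (finAdelic (↥(maximalRealSubfield L)) L (IsCMField.complexConj L) 2 ((StdForm.antidiagonal 2).over L)))) (he0 : ∀ x, x ∉ K' → e x = 0) (he1 : ∫ x, e x ∂νf = 1)
    (heK : ∀ k ∈ K', ∀ x, e (k * x) = e x) (hestar : ∀ x, mulStar (⇑e) x = e x)
    (P : (cmDatum L 2 ((StdForm.antidiagonal 2).over L)).L2 μ →L[ℂ] (cmDatum L 2 ((StdForm.antidiagonal 2).over L)).L2 μ) (hPdef : P = ((((cmDatum L 2 ((StdForm.antidiagonal 2).over L)).rightRegular μ).restrict ((archToAdelic (↥(maximalRealSubfield L)) L (IsCMField.complexConj L) 2 ((StdForm.antidiagonal 2).over L)).comp (Subgroup.inclusion (inf_le_left : UnitaryGroup.arch (↥(maximalRealSubfield L)) L (IsCMField.complexConj L) 2 ((StdForm.antidiagonal 2).over L) ⊓ unitaryGroupOfForm (conjMixed (↥(maximalRealSubfield L)) L (IsCMField.complexConj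 L)) 1 ≤ UnitaryGroup.arch (↥(maximalRealSubfield L)) L (IsCMField.complexConj L) 2 ((StdForm.antidiagonal 2).over L))))).integratedOperator (((cmDatum L 2 ((StdForm.antidiagonal 2).over L)).isUnitary_rightRegular μ).restrict _)
          (((cmDatum L 2 ((StdForm.antidiagonal 2).over L)).isStronglyContinuous_rightRegular_holds μ).restrict _ ((continuous_archToAdelic (↥(maximalRealSubfield L)) L (IsCMField.complexConj L) 2 ((StdForm.antidiagonal 2).over L)).comp (continuous_induced_rng.2 continuous_subtype_val))) μK χ ∘L
        (((cmDatum L 2 ((StdForm.antidiagonal 2).over L)).rightRegular μ).restrict (finAdelicToAdelic (↥(maximalRealSubfield L)) L (IsCMField.complexConj L) 2 ((StdForm.antidiagonal 2).over L))).integratedOperator (((cmDatum L 2 ((StdForm.antidiagonal 2).over L)).isUnitary_rightRegular μ).restrict _) (((cmDatum L 2 ((StdForm.antidiagonal 2).over L)).isStronglyContinuous_rightRegular_holds μ).restrict _ (continuous_finAdelicToAdelic (↥(maximalRealSubfield L)) L (IsCMField.complexConj L) 2 ((StdForm.antidiagonal 2).over L))) νf e))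
    (𝔓 : (cmDatum L 2 ((StdForm.antidiagonal 2).over L)).ParabolicUnipotentData)
    (Kad : Subgroup (cmDatum L 2 ((StdForm.antidiagonal 2).over L)).Adelic) (hKad : Kad ≤ (Subgroup.closure (Set.range (fun k : ↥(UnitaryGroup.arch (↥(maximalRealSubfield L)) L (IsCMField.complexConj L) 2 ((StdForm.antidiagonal 2).over L) ⊓ unitaryGroupOfForm (conjMixed (↥(maximalRealSubfield L)) L (IsCMField.complexConj L)) 1) => (archToAdelic (↥(maximalRealSubfield L)) L (IsCMField.complexConj L) 2 ((StdForm.antidiagonal 2).over L)) ((Subgroup.inclusion (inf_le_left : UnitaryGroup.arch (↥(maximalRealSubfield L)) L (IsCMField.complexConj L) 2 ((StdForm.antidiagonal 2).over L) ⊓ unitaryGroupOfForm (conjMixed (↥(maximalRealSubfield L)) L (IsCMField.complexConj L)) 1 ≤ UnitaryGroup.arch (↥(maximalRealSubfield L)) L (IsCMField.complexConj L) 2 ((StdForm.antidiagonal 2).over L))) k)) ∪ (finAdelicToAdelic (↥(maximalRealSubfield L)) L (IsCMField.complexConj L) 2 ((StdForm.antidiagonal 2).over L)) '' (K' : Set (finAdelic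 (↥(maximalRealSubfield L)) L (IsCMField.complexConj L) 2 ((StdForm.antidiagonal 2).over L))))))
    {ι : Type*} {SK : Set ι} (gen : ↥SK → Set ((cmDatum L 2 ((StdForm.antidiagonal 2).over L)).L2 μ))
    {A : ↥SK → Type*} [∀ b, AddCommGroup (A b)] [∀ b, Module ℂ (A b)] [∀ b, FiniteDimensional ℂ (A b)]
    {Ω : ↥SK → Type*} {mΩ : ∀ b, MeasurableSpace (Ω b)} (m : ∀ b, Measure (Ω b)) {E : ↥SK → Type*} [∀ b, NormedAddCommGroup (E b)] [∀ b, NormedSpace ℂ (E b)]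
    (V : ∀ b, (cmDatum L 2 ((StdForm.antidiagonal 2).over L)).L2 μ →ₗ[ℂ] (A b × Lp (E b) 2 (m b)))
    (Jb : ↥SK → Type*) [∀ b, Countable (Jb b)]
    (h : ∀ b, Jb b → C_c(UnitaryGroup.arch (↥(maximalRealSubfield L)) L (IsCMField.complexConj L) 2 ((StdForm.antidiagonal 2).over L), ℂ))
    (hhl : ∀ b (j : Jb b) (k : ↥(UnitaryGroup.arch (↥(maximalRealSubfield L)) L (IsCMField.complexConj L) 2 ((StdForm.antidiagonal 2).over L) ⊓ unitaryGroupOfForm (conjMixed (↥(maximalRealSubfield L)) L (IsCMField.complexConj L)) 1)) (x : UnitaryGroup.arch (↥(maximalRealSubfield L)) L (IsCMField.complexConj L) 2 ((StdForm.antidiagonal 2).over L)), h b j ((Subgroup.inclusion (inf_le_left : UnitaryGroup.arch (↥(maximalRealSubfield L)) L (IsCMField.complexConj L) 2 ((StdForm.antidiagonal 2).over L) ⊓ unitaryGroupOfForm (conjMixed (↥(maximalRealSubfield L)) L (IsCMField.complexConj L)) 1 ≤ UnitaryGroup.arch (↥(maximalRealSubfield L)) L (IsCMField.complexConj L) 2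 ((StdForm.antidiagonal 2).over L))) k * x) = χ k * h b j x)
    (hhr : ∀ b (j : Jb b) (k : ↥(UnitaryGroup.arch (↥(maximalRealSubfield L)) L (IsCMField.complexConj L) 2 ((StdForm.antidiagonal 2).over L) ⊓ unitaryGroupOfForm (conjMixed (↥(maximalRealSubfield L)) L (IsCMField.complexConj L)) 1)) (x : UnitaryGroup.arch (↥(maximalRealSubfield L)) L (IsCMField.complexConj L) 2 ((StdForm.antidiagonal 2).over L)), h b j (x * (Subgroup.inclusion (inf_le_left : UnitaryGroup.arch (↥(maximalRealSubfield L)) L (IsCMField.complexConj L) 2 ((StdForm.antidiagonal 2).over L) ⊓ unitaryGroupOfForm (conjMixed (↥(maximalRealSubfield L)) L (IsCMField.complexConj L)) 1 ≤ UnitaryGroup.arch (↥(maximalRealSubfield L)) L (IsCMField.complexConj L) 2 ((StdForm.antidiagonal 2).over L))) k) = χ k * h b j x)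
    (s : ∀ b, Jb b → Ω b → ℂ) (hs : ∀ b j, MemLp (s b j) ∞ (m b))
    (hU : ∀ b j, ∀ v ∈ LinearMap.eqLocus (P : (cmDatum L 2 ((StdForm.antidiagonal 2).over L)).L2 μ →ₗ[ℂ] (cmDatum L 2 ((StdForm.antidiagonal 2).over L)).L2 μ) LinearMap.id,
      ((V b ∘ₗ (((Submodule.span ℂ (gen b)).topologicalClosure).starProjection : (cmDatum L 2 ((StdForm.antidiagonal 2).over L)).L2 μ →L[ℂ] (cmDatum L 2 ((StdForm.antidiagonal 2).over L)).L2 μ).toLinearMap) (((((cmDatum L 2 ((StdForm.antidiagonal 2).over L)).rightRegular μ).restrict (archToAdelic (↥(maximalRealSubfield L)) L (IsCMField.complexConj L) 2 ((StdForm.antidiagonal 2).over L))).integratedOperator (((cmDatum L 2 ((StdForm.antidiagonal 2).over L)).isUnitary_rightRegular μ).restrict _) (((cmDatum L 2 ((StdForm.antidiagonal 2).over L)).isStronglyContinuous_rightRegular_holds μ).restrict _ (continuous_archToAdelic (↥(maximalRealSubfield L)) L (IsCMField.complexConj L) 2 ((StdForm.antidiagonal 2).over L))) νinf (h b j) ∘L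 (((cmDatum L 2 ((StdForm.antidiagonal 2).over L)).rightRegular μ).restrict (finAdelicToAdelic (↥(maximalRealSubfield L)) L (IsCMField.complexConj L) 2 ((StdForm.antidiagonal 2).over L))).integratedOperator (((cmDatum L 2 ((StdForm.antidiagonal 2).over L)).isUnitary_rightRegular μ).restrict _) (((cmDatum L 2 ((StdForm.antidiagonal 2).over L)).isStronglyContinuous_rightRegular_holds μ).restrict _ (continuous_finAdelicToAdelic (↥(maximalRealSubfield L)) L (IsCMField.complexConj L) 2 ((StdForm.antidiagonal 2).over L))) νf e) v)).2 = ((hs b j).toLp (s b j) • ((V b ∘ₗ (((Submodule.span ℂ (gen b)).topologicalClosure).starProjection : (cmDatum L 2 ((StdForm.antidiagonal 2).over L)).L2 μ →L[ℂ] (cmDatum L 2 ((StdForm.antidiagonal 2).over L)).L2 μ).toLinearMap) v).2 : Lp (E b) 2 (m b)))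
    (hline : ∀ b (c : Jb b → ℂ), m b {x | ∀ j, s b j x = c j} = 0)
    (hV : ∀ b, ∀ y ∈ (Submodule.span ℂ (gen b)).topologicalClosure, V b y = 0 → y = 0)
    (hC7 : SK.Finite ∧ (∀ b : ↥SK, CompleteSpace ↥(Submodule.span ℂ (gen b)).topologicalClosure) ∧
      (((cmDatum L 2 ((StdForm.antidiagonal 2).over L)).cuspidalSubspace μ 𝔓).toSubmoduleᗮ ⊓ ((((cmDatum L 2 ((StdForm.antidiagonal 2).over L)).rightRegular μ)).restrict Kad.subtype).invariants) ≤ (⨆ b, (Submodule.span ℂ (gen b)).topologicalClosure).topologicalClosure) :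
    FiniteDimensional ℂ ↥((residualSubspace (cmDatum L 2 ((StdForm.antidiagonal 2).over L)) μ 𝔓).toSubmodule ⊓
      ((((cmDatum L 2 ((StdForm.antidiagonal 2).over L)).rightRegular μ)).restrict ((finAdelicToAdelic (↥(maximalRealSubfield L)) L (IsCMField.complexConj L) 2 ((StdForm.antidiagonal 2).over L)).comp K'.subtype)).invariants ⊓
      ((((cmDatum L 2 ((StdForm.antidiagonal 2).over L)).rightRegular μ)).restrict ((archToAdelic (↥(maximalRealSubfield L)) L (IsCMField.complexConj L) 2 ((StdForm.antidiagonal 2).over L)).comp (Subgroup.inclusion (inf_le_left : UnitaryGroup.arch (↥(maximalRealSubfield L)) L (IsCMField.complexConj L) 2 ((StdForm.antidiagonal 2).over L) ⊓ unitaryGroupOfForm (conjMixed (↥(maximalRealSubfield L)) L (IsCMField.complexConj L)) 1 ≤ UnitaryGroup.arch (↥(maximalRealSubfield L)) L (IsCMField.complexConj L) 2 ((StdForm.antidiagonal 2).over L))))).invariants) :=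
  residual_invariants_finiteDimensional_letterFree_of_blocks ((StdForm.antidiagonal 2).over L) μ νinf νf μK χ e
    (antidiagonal_two_over_map (↥(maximalRealSubfield L)) L (IsCMField.complexConj L)) (antidiagonal_two_over_mul_self L) (antidiagonal_two_over_map_embedding L)
    hχ1 K' hK'o he0 he1 heK hestar P hPdef 𝔓 Kad hKad gen m V Jb h hhl hhr s hs hU hline hV hC7

end JTwo


end Summit.HodgeConjecture.HodgeConjecture.Cruxes.H413.K2E1ResidualSphericalFiniteMaximalLevelCMTwoOfBlocks

end
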